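import Literature.Geometry.Lorentzian.OpensCausality
import Literature.Geometry.Lorentzian.DevelopmentImmersionInjective
import HarnessLib

/-!
# Two globally hyperbolic open sub-spacetimes with a common connected Cauchy hypersurface meet in
# a connected set (Sbierski 2016, §3.1, Corollary 8 / Theorem 10: the domain `U₁ ∩ U₂` on which
# two common globally hyperbolic developments are compared)

Third ingredient (after `CauchyDevelopmentRestrict` — common globally hyperbolic developments as
open subsets `U ⊆ M` — and `OpensCausality` — the union of such opens is again globally
hyperbolic) of the construction of the **maximal common globally hyperbolic development** as the
union of all common globally hyperbolic developments (J. Sbierski, Ann. Henri Poincaré 17 (2016)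
= arXiv:1309.7591, §3.1, Thm. "Existence of MCGHD" = arXiv Thm. 10). The isometric immersions
`ψ_α : U_α → M'` of the individual CGHDs are glued along the intersections `U_α ∩ U_β`, where they
agree by the rigidity of isometric immersions (arXiv Cor. 8: *"Then `ψ₁` and `ψ₂` agree on
`U₁ ∩ U₂`"*, from Lemma 7: *"Let `(M, g)` and `(M', g')` be Lorentzian manifolds, where `M` is
connected … It then follows that `ψ₁ = ψ₂`"*). Lemma 7 is an open–closed argument and needs a
**connected** domain; the printed proof of Corollary 8 applies it on `U₁ ∩ U₂` without comment.
This file supplies the missing sentence: `U₁ ∩ U₂` **is connected** whenever `U₁, U₂ ⊆ M` are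
open sub-spacetimes of a spacetime `M` with Cauchy hypersurface `S`, both containing `S`, `S`
connected, and `S` a Cauchy hypersurface of each `(U_i, g|_{U_i}, τ|_{U_i})`
(`LorentzianMetric.IsCauchyHypersurface.isConnected_inter_opens`).

Proof. Let `p ∈ U₁ ∩ U₂` and let `Γ` be the maximal integral curve through `p` of the orienting
timelike field `T` — an endless timelike curve of `M`
(`LorentzianMetric.exists_isEndlessTimelikeCurve_isMIntegralCurveAt`, `DevelopmentImmersionInjective`).
The connected piece of `Γ` through `p` inside `U_i` is an endless timelike curve of `U_i`
(`OpensCausality`: `not_hasFutureEndpoint_connectedComponentIn` and its time dual), hence crosses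
`S` at a parameter `t_i` of that piece (`IsCauchyHypersurface.exists_mem_connectedComponentIn`,
the crossing step of `IsCauchyHypersurface.iSup_opens` isolated as a lemma). As `Γ` meets `S` at
most once in `M` (`IsCauchyHypersurface.eq_of_mem_of_mem`), `t₁ = t₂`, so the whole parameter
segment between `0` and `t₁` lies in both pieces: `Γ([0, t₁]) ⊆ U₁ ∩ U₂` is a connected set
joining `p = Γ 0` to the point `Γ t₁` of the connected set `S ⊆ U₁ ∩ U₂`
(`isPreconnected_of_forall`). For Cauchy developments (`CauchyDevelopment.isConnected_inter_opens`)
`S = ι(X)` is connected as the image of the connected data manifold.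

All results proved; no definitions, no named facts (D-0026).

## References

* J. Sbierski, *On the existence of a maximal Cauchy development for the Einstein equations: a
  dezornification*, Ann. Henri Poincaré 17 (2016) 301–329 = arXiv:1309.7591v3, §3.1: Lemma 7
  (rigidity on a connected domain), Corollary 8 (agreement on `U₁ ∩ U₂`), Theorem 10 (MCGHD as
  the union of all CGHDs).
* B. O'Neill, *Semi-Riemannian geometry with applications to relativity*, Academic Press 1983,
  Ch. 14, Def. 14.28 and Lemma 14.29 (Cauchy hypersurfaces), Prop. 14.31 (proof, p. 417:
  maximal integral curves of a timelike field are inextendible).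
-/

noncomputable section

open Bundle Set Function Filter TopologicalSpace Topology
open scoped Manifold ContDiff Topology

namespace Literature.Geometry.Lorentzian

universe u

/-! ### The crossing of a Cauchy hypersurface inside an open globally hyperbolic sub-spacetime -/

section Opens

variable {E : Type*} [NormedAddCommGroup E] [NormedSpace ℝ E] {H : Type*} [TopologicalSpace H]
  {I : ModelWithCorners ℝ E H} {n : ℕ∞ω} {M : Type*} [TopologicalSpace M] [ChartedSpace H M]
  [IsManifold I ∞ M]

namespace LorentzianMetric

variable {g : LorentzianMetric I n M} {τ : TimeOrientation g}
  (hres : PseudoRiemannianMetric.contMDiff_restrict (I := I) (n := n) (M := M))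
  (hτ : τ.contMDiff_restrict)

/-- **The piece of an endless timelike curve inside an open globally hyperbolic sub-spacetime
crosses its Cauchy hypersurface.** Let `V ⊆ M` be an open sub-spacetime in which
`S ∩ V` is a Cauchy hypersurface (for `g|_V`, `τ|_V`), and `γ` an endless timelike curve of `M`
on the parameter interval `s` with `γ t₀ ∈ V`. Then `γ` meets `S` at some parameter of the
connected component `J` of `t₀` in `{t ∈ s | γ t ∈ V}`: the piece `γ|_J` is an endless timelike
curve of `V` (`not_hasFutureEndpoint_connectedComponentIn` and its time dual: it either runs to
the end of `s` or leaves `V`). This is *"Take a point on `γ`; it lies in some `U_α` and the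
corresponding curve segment in `U_α` can be considered to be an inextendible timelike curve in
`U_α` and thus has to meet `ι(M̄)`"* (Sbierski 2016, §3.1, proof of Thm. 10), the crossing step
of `IsCauchyHypersurface.iSup_opens` isolated. [cite: Sbierski2016AHP, §3.1, proof of Thm. 10 (existence of the MCGHD)] -/
theorem IsCauchyHypersurface.exists_mem_connectedComponentIn [T2Space M] {S : Set M}
    {V : Opens M}
    (hV : (g.restrict hres V).IsCauchyHypersurface (τ.restrict hres hτ V) (Subtype.val ⁻¹' S))
    {γ : ℝ → M} {s : Set ℝ} (hγ : g.IsEndlessTimelikeCurve τ γ s) {t₀ : ℝ} (ht₀ : t₀ ∈ s)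
    (hγt₀ : γ t₀ ∈ V) :
    ∃ t₁ ∈ connectedComponentIn (s ∩ γ ⁻¹' (V : Set M)) t₀, γ t₁ ∈ S := by
  classical
  obtain ⟨hs, hγt, hγf, hγp⟩ := hγ
  have hcont : ∀ t ∈ s, ContinuousAt γ t := fun t ht ↦ (hγt t ht).1.continuousAt
  set J := connectedComponentIn (s ∩ γ ⁻¹' (V : Set M)) t₀ with hJ
  have ht₀J : t₀ ∈ J := mem_connectedComponentIn ⟨ht₀, hγt₀⟩
  have hJsub : J ⊆ s ∩ γ ⁻¹' (V : Set M) := connectedComponentIn_subset _ _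
  have hJord : J.OrdConnected :=
    isPreconnected_iff_ordConnected.1 isPreconnected_connectedComponentIn
  -- the piece, as a curve of `V`
  set δ : ℝ → V := fun t ↦ if h : γ t ∈ V then ⟨γ t, h⟩ else ⟨γ t₀, hγt₀⟩ with hδ
  have hδval : ∀ t ∈ J, (δ t : M) = γ t := fun t ht ↦ by
    have hmem : γ t ∈ V := (hJsub ht).2
    show Subtype.val (if h : γ t ∈ V then (⟨γ t, h⟩ : V) else (⟨γ t₀, hγt₀⟩ : V)) = γ t
    rw [dif_pos hmem]
  have hδev : ∀ t ∈ J, (Subtype.val ∘ δ) =ᶠ[𝓝 t] γ := fun t ht ↦ by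
    have hmem : γ ⁻¹' (V : Set M) ∈ 𝓝 t :=
      (hcont t (hJsub ht).1).preimage_mem_nhds (V.2.mem_nhds (hJsub ht).2)
    filter_upwards [hmem] with t' ht'
    simp only [comp_apply, hδ, dif_pos (show γ t' ∈ V from ht')]
  -- `δ` is a future timelike curve of `V` on `J`
  have hδt : (g.restrict hres V).IsFutureTimelikeCurveOn (τ.restrict hres hτ V) δ J := by
    rw [isFutureTimelikeCurveOn_restrict_iff]
    intro t ht
    obtain ⟨hd, h1, h2⟩ := hγt t (hJsub ht).1
    have hveq : velocity I (Subtype.val ∘ δ) t = velocity I γ t :=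
      DFunLike.congr_fun (hδev t ht).mfderiv_eq (1 : ℝ)
    refine ⟨(hδev t ht).mdifferentiableAt_iff.2 hd, ?_, ?_⟩
    · change g.val (δ t : M) (velocity I (Subtype.val ∘ δ) t) (velocity I (Subtype.val ∘ δ) t) < 0
      rw [hveq, hδval t ht]
      exact h1
    · change (g.val (δ t : M) (velocity I (Subtype.val ∘ δ) t)
          (velocity I (Subtype.val ∘ δ) t) ≤ 0 ∧ velocity I (Subtype.val ∘ δ) t ≠ 0) ∧
        g.val (δ t : M) (τ.vectorField (δ t : M)) (velocity I (Subtype.val ∘ δ) t) < 0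
      rw [hveq, hδval t ht]
      exact h2
  -- `δ` is endless on `J` (in `V`)
  have hδf : IsFutureEndless δ J := by
    refine ⟨⟨t₀, ht₀J⟩, fun q hq ↦ ?_⟩
    have h1 : HasFutureEndpoint (Subtype.val ∘ δ) J (q : M) :=
      hasFutureEndpoint_subtypeVal_comp_iff.2 hq
    have h2 : HasFutureEndpoint γ J (q : M) := h1.congr fun t ↦ hδval t t.2
    exact not_hasFutureEndpoint_connectedComponentIn hs hcont hγf V.2 ht₀ hγt₀ q.2 h2
  have hδp : IsPastEndless δ J := by
    refine ⟨⟨t₀, ht₀J⟩, fun q hq ↦ ?_⟩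
    have h1 : HasPastEndpoint (Subtype.val ∘ δ) J (q : M) :=
      hasPastEndpoint_subtypeVal_comp_iff.2 hq
    have h2 : HasPastEndpoint γ J (q : M) := h1.congr fun t ↦ hδval t t.2
    exact not_hasPastEndpoint_connectedComponentIn hs hcont hγp V.2 ht₀ hγt₀ q.2 h2
  -- hence `δ` meets `S`
  obtain ⟨t₁, ⟨ht₁J, ht₁S⟩, -⟩ := hV δ J ⟨hJord, hδt, hδf, hδp⟩
  refine ⟨t₁, ht₁J, ?_⟩
  have h : (δ t₁ : M) ∈ S := ht₁S
  rwa [hδval t₁ ht₁J] at h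

/-! ### The intersection of two globally hyperbolic opens with a common Cauchy hypersurface -/

/-- **Two open globally hyperbolic sub-spacetimes with a common connected Cauchy hypersurface meet
in a connected set.** Let `S` be a connected Cauchy hypersurface of `(M, g, τ)` (Hausdorff, second
countable, without boundary, finite-dimensional, `C²`) and `U₁, U₂ ⊆ M` open subsets containing
`S` such that `S` is a Cauchy hypersurface of each `(U_i, g|_{U_i}, τ|_{U_i})`. Then `U₁ ∩ U₂` is
connected: through `p ∈ U₁ ∩ U₂` runs the maximal integral curve `Γ` of the orienting field, an
endless timelike curve of `M` (`exists_isEndlessTimelikeCurve_isMIntegralCurveAt`); its pieces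
through `p` inside `U₁` and inside `U₂` both cross `S`
(`IsCauchyHypersurface.exists_mem_connectedComponentIn`), at the same parameter `t₁` since `Γ`
meets `S` at most once in `M` (`IsCauchyHypersurface.eq_of_mem_of_mem`), so `Γ([0, t₁])` is a
connected subset of `U₁ ∩ U₂` joining `p` to the connected set `S ⊆ U₁ ∩ U₂`. This is the
connectedness of the domain `U₁ ∩ U₂` on which Sbierski's Corollary 8 (2016, §3.1) invokes the
rigidity Lemma 7, stated there for connected `M`. [cite: Sbierski2016AHP, §3.1, Cor. 8 with Lemma 7 (arXiv numbering)] -/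
theorem IsCauchyHypersurface.isConnected_inter_opens [T2Space M] [SecondCountableTopology M]
    [BoundarylessManifold I M] [FiniteDimensional ℝ E] (hn : 2 ≤ n) {S : Set M}
    (hS : g.IsCauchyHypersurface τ S) (hSc : IsConnected S) {U₁ U₂ : Opens M}
    (h₁ : S ⊆ U₁) (h₂ : S ⊆ U₂)
    (hU₁ : (g.restrict hres U₁).IsCauchyHypersurface (τ.restrict hres hτ U₁) (Subtype.val ⁻¹' S))
    (hU₂ : (g.restrict hres U₂).IsCauchyHypersurface (τ.restrict hres hτ U₂) (Subtype.val ⁻¹' S)) :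
    IsConnected ((U₁ : Set M) ∩ U₂) := by
  classical
  haveI : CompleteSpace E := FiniteDimensional.complete ℝ E
  have hn1 : (1 : ℕ∞ω) ≤ n := le_trans one_le_two hn
  have hT1 : ContMDiff I I.tangent 1 (fun x ↦ (⟨x, τ.vectorField x⟩ : TangentBundle I M)) :=
    τ.contMDiff.of_le hn1
  obtain ⟨x₀, hx₀⟩ := hSc.nonempty
  refine ⟨⟨x₀, h₁ hx₀, h₂ hx₀⟩, isPreconnected_of_forall x₀ fun p hp ↦ ?_⟩
  -- the maximal integral curve of the orienting field through `p`
  obtain ⟨Γ, D, hΓ, -, h0D, hΓ0, -⟩ :=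
    g.exists_isEndlessTimelikeCurve_isMIntegralCurveAt τ hT1 τ.isTimelike
      τ.isFutureDirected_vectorField p
  have hp₁ : Γ 0 ∈ U₁ := by rw [hΓ0]; exact hp.1
  have hp₂ : Γ 0 ∈ U₂ := by rw [hΓ0]; exact hp.2
  -- its pieces through `p` inside `U₁` and inside `U₂` cross `S`
  set J₁ := connectedComponentIn (D ∩ Γ ⁻¹' (U₁ : Set M)) 0 with hJ₁
  set J₂ := connectedComponentIn (D ∩ Γ ⁻¹' (U₂ : Set M)) 0 with hJ₂
  obtain ⟨t₁, ht₁J, ht₁S⟩ :=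
    IsCauchyHypersurface.exists_mem_connectedComponentIn hres hτ hU₁ hΓ h0D hp₁
  obtain ⟨t₂, ht₂J, ht₂S⟩ :=
    IsCauchyHypersurface.exists_mem_connectedComponentIn hres hτ hU₂ hΓ h0D hp₂
  have hJ₁sub : J₁ ⊆ D ∩ Γ ⁻¹' (U₁ : Set M) := connectedComponentIn_subset _ _
  have hJ₂sub : J₂ ⊆ D ∩ Γ ⁻¹' (U₂ : Set M) := connectedComponentIn_subset _ _
  -- at most one crossing of `S` in `M`: `t₁ = t₂`
  have h12 : t₁ = t₂ :=
    IsCauchyHypersurface.eq_of_mem_of_mem hn hS hΓ.1 hΓ.2.1 (hJ₁sub ht₁J).1 (hJ₂sub ht₂J).1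
      ht₁S ht₂S
  subst h12
  -- the parameter segment between `0` and `t₁` lies in both pieces
  have hJ₁ord : J₁.OrdConnected :=
    isPreconnected_iff_ordConnected.1 isPreconnected_connectedComponentIn
  have hJ₂ord : J₂.OrdConnected :=
    isPreconnected_iff_ordConnected.1 isPreconnected_connectedComponentIn
  have hseg₁ : uIcc 0 t₁ ⊆ J₁ := hJ₁ord.uIcc_subset (mem_connectedComponentIn ⟨h0D, hp₁⟩) ht₁J
  have hseg₂ : uIcc 0 t₁ ⊆ J₂ := hJ₂ord.uIcc_subset (mem_connectedComponentIn ⟨h0D, hp₂⟩) ht₂J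
  have hcontΓ : ContinuousOn Γ (uIcc 0 t₁) := fun t ht ↦
    (hΓ.2.1 t (hJ₁sub (hseg₁ ht)).1).1.continuousAt.continuousWithinAt
  -- `S ∪ Γ([0, t₁])` is a connected subset of `U₁ ∩ U₂` containing `x₀` and `p`
  refine ⟨S ∪ Γ '' uIcc 0 t₁, ?_, Or.inl hx₀, Or.inr ⟨0, left_mem_uIcc, hΓ0⟩, ?_⟩
  · rintro y (hy | ⟨t, ht, rfl⟩)
    · exact ⟨h₁ hy, h₂ hy⟩
    · exact ⟨(hJ₁sub (hseg₁ ht)).2, (hJ₂sub (hseg₂ ht)).2⟩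
  · exact hSc.isPreconnected.union (Γ t₁) ht₁S ⟨t₁, right_mem_uIcc, rfl⟩
      (isPreconnected_uIcc.image Γ hcontΓ)

end LorentzianMetric

end Opens

/-! ### Cauchy developments: two sub-developments meet in a connected open set -/

section Developments

variable {n : ℕ} {X : Type u} [TopologicalSpace X] [ChartedSpace (EuclideanSpace ℝ (Fin n)) X]
  [IsManifold (𝓡 n) ∞ X] [ConnectedSpace X] {D : InitialDataSet (𝓡 n) X}

namespace CauchyDevelopment

/-- The data hypersurface `ι(X)` of a Cauchy development is connected (image of the connected
data manifold under the continuous embedding). [folklore] -/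
theorem isConnected_range_embed (𝒟 : CauchyDevelopment D) : IsConnected (range 𝒟.embed) :=
  isConnected_range 𝒟.isSmoothEmbedding.contMDiff.continuous

/-- **Two globally hyperbolic sub-developments of a Cauchy development meet in a connected open
set** (the domain of Sbierski's Corollary 8, 2016, §3.1): if `U₁, U₂ ⊆ M` are open subsets of the
spacetime of a Cauchy development `𝒟` of `D`, both containing `ι(X)`, and `ι(X)` is a Cauchy
hypersurface of each open sub-spacetime `(U_i, g|_{U_i}, τ|_{U_i})` — the defining condition of a
(common) globally hyperbolic development `U_i ⊆ M`, Sbierski 2016, Def. 2.4 /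
`CauchyDevelopment.restrict` — then `U₁ ∩ U₂` is connected
(`LorentzianMetric.IsCauchyHypersurface.isConnected_inter_opens` with `S = ι(X)`, connected as
the image of the connected data manifold). [cite: Sbierski2016AHP, §3.1, Cor. 8 with Lemma 7 (arXiv numbering)] -/
theorem isConnected_inter_opens (𝒟 : CauchyDevelopment D) {U₁ U₂ : Opens 𝒟.carrier}
    (h₁ : ∀ x, 𝒟.embed x ∈ U₁) (h₂ : ∀ x, 𝒟.embed x ∈ U₂)
    (hU₁ : (𝒟.metric.restrict PseudoRiemannianMetric.contMDiff_restrict_holds U₁).IsCauchyHypersurface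
      (𝒟.timeOrientation.restrict PseudoRiemannianMetric.contMDiff_restrict_holds
        𝒟.timeOrientation.contMDiff_restrict_holds U₁) (Subtype.val ⁻¹' range 𝒟.embed))
    (hU₂ : (𝒟.metric.restrict PseudoRiemannianMetric.contMDiff_restrict_holds U₂).IsCauchyHypersurface
      (𝒟.timeOrientation.restrict PseudoRiemannianMetric.contMDiff_restrict_holds
        𝒟.timeOrientation.contMDiff_restrict_holds U₂) (Subtype.val ⁻¹' range 𝒟.embed)) :
    IsConnected ((U₁ : Set 𝒟.carrier) ∩ U₂) :=
  LorentzianMetric.IsCauchyHypersurface.isConnected_inter_opens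
    PseudoRiemannianMetric.contMDiff_restrict_holds 𝒟.timeOrientation.contMDiff_restrict_holds
    (WithTop.coe_le_coe.mpr le_top) 𝒟.isCauchyHypersurface 𝒟.isConnected_range_embed
    (range_subset_iff.2 h₁) (range_subset_iff.2 h₂) hU₁ hU₂

end CauchyDevelopment

end Developments

end Literature.Geometry.Lorentzian

end
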